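import Literature.Analysis.FluidPDE.OnsagerBDSVPerturbation
import HarnessLib

/-!
# The BDSV perturbation: deformation and material-derivative bounds (Props. 5.7, 5.9) as named facts

Buckmaster–De Lellis–Székelyhidi–Vicol (BDSV), *Onsager's conjecture for admissible weak
solutions*, CPAM 72 (2019) = arXiv:1701.08678, §5.5, control the backward flows `Φ_i` of `v̄_q`
and the conjugated stresses `R̃_{q,i} = ∇Φ_i R_{q,i} ∇Φ_iᵀ/ρ_{q,i}` entering the Mikado
perturbation, together with their material derivatives `D_{t,q} = ∂ₜ + v̄_q·∇`, on the time
intervals `Ĩ_i = (t_i - τ_q/3, t_{i+1} + τ_q/3) ∩ [0,T]` carrying the cut-off `η_i`: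

> **Prop. 5.7.** For `t ∈ Ĩ_i` and any `N ≥ 0`:
> (arXiv (5.23)) `‖(∇Φ_i)⁻¹‖_N + ‖∇Φ_i‖_N ≲ ℓ^{-N}`, (arXiv (5.24)) `‖R̃_{q,i}‖_N ≲ ℓ^{-N}`, …
> "the symbol `≲` denotes a dependence of the constants in the estimates from `N`, `α`, `β` and
> `M`, but not upon `k` or `a`."
>
> **Prop. 5.9.** For `t ∈ Ĩ_i` and `N ≥ 0`:
> (arXiv (5.37)) `‖D_{t,q} ∇Φ_i‖_N ≲ δ_q^{1/2} λ_q ℓ^{-N}`, (arXiv (5.38)) `‖D_{t,q} R̃_{q,i}‖_N ≲ τ_q^{-1} ℓ^{-N}`, …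

(the remaining items, (5.25)–(5.26) and (5.39), concern the Fourier amplitudes `b_{i,k}`,
`c_{i,k}` of the perturbation and are not transcribed here). These are the inputs of the
transport-error estimate of §6.1.2 (`BDSV.transportErrorEstimate`, `OnsagerBDSVStressSplit.lean`)
and, for (5.23)–(5.24), of every estimate of §§5.5–6. This file transcribes the four displayed
estimates as **named facts** (`def … : Prop`, D-0014) about the honest objects of
`OnsagerBDSVPerturbation.lean` — `BDSV.gradPhi 𝒟.D i` (`∇Φ_i = Id + ∇D_i`), its matrix inverse,
`BDSV.tildeR` (the form (5.32)/arXiv (5.27) of `R̃_{q,i}`), and the material derivative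
`BDSV.advectiveDeriv S.T S.vbar` — under the standing hypotheses `BDSV.PerturbationHypotheses` and
for arbitrary construction data `BDSV.PerturbationData`:

* `BDSV.gradPhiBound` (arXiv (5.23)), `BDSV.tildeRBound` (arXiv (5.24)),
  `BDSV.gradPhiTransportBound` (arXiv (5.37)), `BDSV.tildeRTransportBound` (arXiv (5.38)).

## Transcription

* Quantifiers: the shared prefix of the stage facts (`OnsagerBDSVPerturbation.lean`,
  `BDSV.stressEstimate`) with the number of derivatives `N` inserted after `α` —
  `∀ c₀ > 0, ∀ C_η, ∀ β b, ∃ α₀, ∀ α < α₀, ∀ N, ∃ N̄, ∀ C_in C₀, ∃ C a₀, ∀ a ≥ a₀, ∀ S, hypotheses →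
  ∀ data, ∀ i, …`: the implicit constant depends on `N, α, β` (and on `c₀`, the cut-off constants
  `C(n,m)` of Lemma 5.3 and `C_in`), never on `a`, `q`, `i` or the data; `N̄ = N̄(N)` derivatives of
  the standing estimates (2.19)–(2.21) are consumed; "`a` sufficiently large" (Lemma 5.4, used in
  the proofs) is the threshold `a₀`; `α` small is needed through Lemma 5.4 (`4δ_{q+2} ≤ δ_{q+1}λ_q^{-α}`).
  The Mikado datum does not enter these four statements.
* Norms: `‖·‖_N` on `Ĩ_i` is `BDSV.HolderSupOnLE (Ĩ_i) · N 0` (the accepted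
  `Torus.eContDiffHolderNorm N 0`, i.e. `∑_{j≤N} ‖Dʲ·‖_∞ + osc(D^N·)`, equivalent to the integer
  norm up to a factor `3`), matrices carrying the elementwise sup norm
  (`Matrix.Norms.Elementwise`); (5.23) is split into its two summands with a common constant.
* `Ĩ_i = [0,T] ∩ (iτ_q - τ_q/3, (i+1)τ_q + τ_q/3)`, `τ_q = BDSV.Params.τ` (`BDSV.glueScale`),
  `ℓ = BDSV.mollScale`, `δ_q = BDSV.amp`, `λ_q = BDSV.freq`; `BDSV.tildeInterval`.

## References

* T. Buckmaster, C. De Lellis, L. Székelyhidi Jr., V. Vicol, *Onsager's conjecture for admissible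
  weak solutions*, Comm. Pure Appl. Math. 72 (2019) 229–274 = arXiv:1701.08678, §5.2 (`Ĩ_i`),
  §5.5 Prop. 5.7 (arXiv (5.23)–(5.26)) and Prop. 5.9 (arXiv (5.37)–(5.39)) with their proofs
  (App. B (B.5)–(B.6), Lemma 5.4). Equation numbers are those of arXiv:1701.08678v1
  (cf. `OnsagerBDSVStressSplit.lean`, "Numbering").
-/

open MeasureTheory Set
open scoped NNReal ENNReal ContDiff Matrix Matrix.Norms.Elementwise

noncomputable section

namespace Literature.Analysis.FluidPDE

namespace BDSV

open FunctionSpaces FunctionSpaces.Torus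

/-- The flat three-torus `T³ = (ℝ/ℤ)³`, local notation. -/
local notation "𝕋³" => UnitAddTorus (Fin 3)

/-- Euclidean `ℝ³`, local notation. -/
local notation "ℝ³" => EuclideanSpace ℝ (Fin 3)

/-- Real `3 × 3` matrices, local notation. -/
local notation "𝕄" => Matrix (Fin 3) (Fin 3) ℝ

/-! ## The intervals `Ĩ_i` -/

section Intervals

/-- The time interval `Ĩ_i = (t_i - τ/3, t_{i+1} + τ/3) ∩ [0,T]`, `t_i = iτ`, on which the
cut-off `η_i` may be non-zero (§5.2, property (iv) and the display defining `Ĩ_i`).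
[cite: BuckmasterEtAl2018, §5.2 (iv)] -/
def tildeInterval (T τ : ℝ) (i : ℕ) : Set ℝ :=
  Icc 0 T ∩ Ioo ((i : ℝ) * τ - τ / 3) (((i : ℝ) + 1) * τ + τ / 3)

/-- `Ĩ_i ⊂ [0,T]`. [folklore] -/
theorem tildeInterval_subset_Icc (T τ : ℝ) (i : ℕ) : tildeInterval T τ i ⊆ Icc 0 T :=
  inter_subset_left

/-- The support of `η_i` lies over `Ĩ_i`: if `η_i(t,x) ≠ 0` with `t ∈ [0,T]` then `t ∈ Ĩ_i`
(property (iv) of the cut-offs). [cite: BuckmasterEtAl2018, §5.2 (iv)] -/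
theorem CutoffFamily.mem_tildeInterval {T τ c₀ : ℝ} {Cη : ℕ → ℕ → ℝ} (cut : CutoffFamily T τ c₀ Cη)
    {i : ℕ} {t : ℝ} (ht : t ∈ Icc 0 T) {x : 𝕋³} (h : cut.η i t x ≠ 0) :
    t ∈ tildeInterval T τ i :=
  ⟨ht, cut.support i t x h⟩

end Intervals

/-! ## Props. 5.7 and 5.9 (deformation part) as named facts -/

section Facts

/-- **The deformation bound** (BDSV Prop. 5.7, first item, arXiv (5.23): "For `t ∈ Ĩ_i` and any
`N ≥ 0`, `‖(∇Φ_i)⁻¹‖_N + ‖∇Φ_i‖_N ≲ ℓ^{-N}`", constants depending on `N, α, β, M` but not on `a`;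
proof from (2.19), (B.5)–(B.6) and `‖∇Φ_i - Id‖₀ ≤ 1/2` (Lemma 5.4), for `a` large). Transcription
(module docstring): for the deformation `∇Φ_i = BDSV.gradPhi 𝒟.D i` of the backward flows of any
construction data and its matrix inverse, both `C^N` norms on `Ĩ_i` are at most `C ℓ^{-N}`.
[cite: BuckmasterEtAl2018, Prop. 5.7 (arXiv (5.23))] -/
def gradPhiBound : Prop :=
  ∀ (c₀ : ℝ), 0 < c₀ → ∀ Cη : ℕ → ℕ → ℝ,
    ∀ β : ℝ, 0 < β → β < 1 / 3 → ∀ b : ℝ, 1 < b → b < (1 - β) / (2 * β) →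
      ∃ α₀ : ℝ, 0 < α₀ ∧ ∀ α : ℝ, 0 < α → α < α₀ → ∀ N : ℕ, ∃ Nbar : ℕ, ∀ Cin C₀ : ℝ,
        ∃ C a₀ : ℝ, 1 < a₀ ∧ ∀ a : ℝ, a₀ ≤ a → ∀ S : Setting,
          PerturbationHypotheses ⟨β, α, a, b⟩ S Nbar Cin C₀ →
            ∀ (𝒟 : PerturbationData ⟨β, α, a, b⟩ S c₀ Cη) (i : ℕ),
              HolderSupOnLE (tildeInterval S.T (Params.τ ⟨β, α, a, b⟩ S.q) i)
                  (fun t x => gradPhi 𝒟.D i t x) N 0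
                  (C * mollScale β α a b S.q ^ (-(N : ℝ))) ∧
                HolderSupOnLE (tildeInterval S.T (Params.τ ⟨β, α, a, b⟩ S.q) i)
                  (fun t x => (gradPhi 𝒟.D i t x)⁻¹) N 0
                  (C * mollScale β α a b S.q ^ (-(N : ℝ)))

/-- **The conjugated-stress bound** (BDSV Prop. 5.7, second item, arXiv (5.24): "For `t ∈ Ĩ_i` and
any `N ≥ 0`, `‖R̃_{q,i}‖_N ≲ ℓ^{-N}`"; proof: the form arXiv (5.27)
`R_{q,i}/ρ_{q,i} = Id - (Σ_j∫η_j²/ρ_q) R̊̄_q` valid on `supp R̊̄_q`, (5.28), Lemma 5.4 and (5.23)).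
Transcription (module docstring): for `R̃_{q,i} = BDSV.tildeR` (which is the (5.27) form globally),
`‖R̃_{q,i}(t)‖_{C^N} ≤ C ℓ^{-N}` for `t ∈ Ĩ_i`. [cite: BuckmasterEtAl2018, Prop. 5.7 (arXiv (5.24))] -/
def tildeRBound : Prop :=
  ∀ (c₀ : ℝ), 0 < c₀ → ∀ Cη : ℕ → ℕ → ℝ,
    ∀ β : ℝ, 0 < β → β < 1 / 3 → ∀ b : ℝ, 1 < b → b < (1 - β) / (2 * β) →
      ∃ α₀ : ℝ, 0 < α₀ ∧ ∀ α : ℝ, 0 < α → α < α₀ → ∀ N : ℕ, ∃ Nbar : ℕ, ∀ Cin C₀ : ℝ,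
        ∃ C a₀ : ℝ, 1 < a₀ ∧ ∀ a : ℝ, a₀ ≤ a → ∀ S : Setting,
          PerturbationHypotheses ⟨β, α, a, b⟩ S Nbar Cin C₀ →
            ∀ (𝒟 : PerturbationData ⟨β, α, a, b⟩ S c₀ Cη) (i : ℕ),
              HolderSupOnLE (tildeInterval S.T (Params.τ ⟨β, α, a, b⟩ S.q) i)
                (fun t x => tildeR ⟨β, α, a, b⟩ S 𝒟.cut.η 𝒟.D i t x) N 0
                (C * mollScale β α a b S.q ^ (-(N : ℝ)))

/-- **Material derivative of the deformation** (BDSV Prop. 5.9, first item, arXiv (5.37): "For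
`t ∈ Ĩ_i` and `N ≥ 0` we have `‖D_{t,q} ∇Φ_i‖_N ≲ δ_q^{1/2} λ_q ℓ^{-N}`", `D_{t,q} = ∂ₜ + v̄_q·∇`;
proof: `D_{t,q}∇Φ_i = -∇Φ_i Dv̄_q`, (2.19) and (5.23)). Transcription (module docstring): with
`D_{t,q} = BDSV.advectiveDeriv S.T S.vbar` (one-sided time derivative within `[0,T]`) applied to
the matrix field `∇Φ_i = BDSV.gradPhi 𝒟.D i`. [cite: BuckmasterEtAl2018, Prop. 5.9 (arXiv (5.37))] -/
def gradPhiTransportBound : Prop :=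
  ∀ (c₀ : ℝ), 0 < c₀ → ∀ Cη : ℕ → ℕ → ℝ,
    ∀ β : ℝ, 0 < β → β < 1 / 3 → ∀ b : ℝ, 1 < b → b < (1 - β) / (2 * β) →
      ∃ α₀ : ℝ, 0 < α₀ ∧ ∀ α : ℝ, 0 < α → α < α₀ → ∀ N : ℕ, ∃ Nbar : ℕ, ∀ Cin C₀ : ℝ,
        ∃ C a₀ : ℝ, 1 < a₀ ∧ ∀ a : ℝ, a₀ ≤ a → ∀ S : Setting,
          PerturbationHypotheses ⟨β, α, a, b⟩ S Nbar Cin C₀ →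
            ∀ (𝒟 : PerturbationData ⟨β, α, a, b⟩ S c₀ Cη) (i : ℕ),
              HolderSupOnLE (tildeInterval S.T (Params.τ ⟨β, α, a, b⟩ S.q) i)
                (advectiveDeriv S.T S.vbar fun t x => gradPhi 𝒟.D i t x) N 0
                (C * (Real.sqrt (amp β a b S.q) * freq a b S.q * mollScale β α a b S.q ^ (-(N : ℝ))))

/-- **Material derivative of the conjugated stress** (BDSV Prop. 5.9, second item, arXiv (5.38):
"`‖D_{t,q} R̃_{q,i}‖_N ≲ τ_q^{-1} ℓ^{-N}`" for `t ∈ Ĩ_i`, `N ≥ 0`; proof: arXiv (5.40)–(5.42),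
differentiating (5.27) along the flow, with (2.20)–(2.21), Lemma 5.4, (5.23) and (5.37)).
Transcription as in `BDSV.gradPhiTransportBound`, for `R̃_{q,i} = BDSV.tildeR`, with
`τ_q = BDSV.Params.τ` (`BDSV.glueScale`). [cite: BuckmasterEtAl2018, Prop. 5.9 (arXiv (5.38))] -/
def tildeRTransportBound : Prop :=
  ∀ (c₀ : ℝ), 0 < c₀ → ∀ Cη : ℕ → ℕ → ℝ,
    ∀ β : ℝ, 0 < β → β < 1 / 3 → ∀ b : ℝ, 1 < b → b < (1 - β) / (2 * β) →
      ∃ α₀ : ℝ, 0 < α₀ ∧ ∀ α : ℝ, 0 < α → α < α₀ → ∀ N : ℕ, ∃ Nbar : ℕ, ∀ Cin C₀ : ℝ,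
        ∃ C a₀ : ℝ, 1 < a₀ ∧ ∀ a : ℝ, a₀ ≤ a → ∀ S : Setting,
          PerturbationHypotheses ⟨β, α, a, b⟩ S Nbar Cin C₀ →
            ∀ (𝒟 : PerturbationData ⟨β, α, a, b⟩ S c₀ Cη) (i : ℕ),
              HolderSupOnLE (tildeInterval S.T (Params.τ ⟨β, α, a, b⟩ S.q) i)
                (advectiveDeriv S.T S.vbar (tildeR ⟨β, α, a, b⟩ S 𝒟.cut.η 𝒟.D i)) N 0
                (C * ((Params.τ ⟨β, α, a, b⟩ S.q)⁻¹ * mollScale β α a b S.q ^ (-(N : ℝ))))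

end Facts

end BDSV

end Literature.Analysis.FluidPDE
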